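import Summits.BirchSwinnertonDyer.BirchSwinnertonDyer.Theorems.ManinLocalTwoThreeShimuraQuotientRational
import Summits.BirchSwinnertonDyer.BirchSwinnertonDyer.Theorems.ManinLocalTwoThreeBlindTransferFourP
import HarnessLib

/-!
# E-an-66 at EVERY level `4 ∣ N` modulo the cusp-rationality fact: on a totally blind optimal curve `|c₀| = |c₁|`,
# so C2 there ⟺ Stevens' parity — the general-level twin of `…BlindTransferFourP.lean`

Summit `BirchSwinnertonDyer`, route `ManinLocalTwoThree` (cell bsd-f2-manin), deciding crux C2 `ManinOddAtFour`
(stmt-BirchSwinnertonDyer-22967), blind residual (stubs `stub_blindTameOptimalOddDegree` / `stub_rbTotallyBlindWildOrbitMinimal`;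
an rows E-an-66/68/69/70); prover seat bsd-line-manin23-p1 (C2/C3 LEAD), gen 10.  `…BlindTransferFourP.lean` (gen 6) proved
E-an-66 UNCONDITIONALLY at `N = 4q` (`(ℤ/q)ˣ` cyclic: no index `4` there) and reduced the general level to «no index `4` on blind
optimal pairs» (`totallyBlindGammaOneTransfer_of_noIndexFour`).  `…ShimuraQuotientRational.lean` (gen 10) supplies exactly that
statement from the printed fact F★ = `optimalGamma1Parametrization_cusp_rational` (Conrad–Edixhoven–Stein 2003 §6.1.2/§6.2,
tree named fact, p673905): index `4` would put two distinct RATIONAL `2`-torsion roots on `W₀`, both blind — against E-an-71.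

* `noIndexFour_of_allBlind_of_cusp_rational` — F★ ⟹ no totally blind optimal pair at `4 ∣ N` has `Λ₁(f) = 2Λ₀(f)`
  (the hypothesis of `totallyBlindGammaOneTransfer_of_noIndexFour`, discharged modulo F★).
* `natAbs_maninConstant₀_eq_of_allBlind_of_cusp_rational` — E-an-66 unpacked at every `4 ∣ N`: `|c₀| = |c₁|`.
* `not_two_dvd_maninConstant₀_iff_of_allBlind_of_cusp_rational`, `dvd_maninConstant₀_iff_…` — `2 ∤ c₀ ⟺ 2 ∤ c₁`
  (indeed `ℓ ∣ c₀ ⟺ ℓ ∣ c₁`): on the totally blind locus Manin's conjecture at `2` IS Stevens' parity.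
* `not_two_dvd_maninConstant_of_allBlind_of_cusp_rational` — C2 on every totally blind lattice-optimal curve at `4 ∣ N` ⟸
  F★ ∧ `exists_optimal_gamma1ParametrizationData` (CES §6.1) ∧ Stevens' parity for the `X₁(N)`-optimal data of those classes
  (inline hypothesis; CES Conj. 6.1.7 predicts `c₁ = 1`).

HONEST FRAMING: conditional on F★ (and, for the last, on the existence fact and Stevens' parity); the blind stubs of C2 are
REFORMULATED (C2 ⟺ Stevens there), not closed; C2, Manin's conjecture and BSD are NOT proved by this file.  No definitions, no sorry.
-/

set_option autoImplicit false
set_option linter.dupNamespace false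

noncomputable section

open WeierstrassCurve Literature.NumberTheory.EllipticCurves Literature.NumberTheory.EllipticCurves.ModularForms
open CongruenceSubgroup
open Summit.BirchSwinnertonDyer.Rank1Residual.ManinAdditive.ShimuraLedger

namespace Summit.BirchSwinnertonDyer.BirchSwinnertonDyer.Theorems.ManinLocalTwoThree

/-- **F★ ⟹ no index `4` on totally blind optimal pairs** (`4 ∣ N`, `W₀ = [0, a₂, 0, a₄, a₆]` globally minimal with all rational
`2`-torsion Kummer-blind): `Λ₁(f) = 2Λ₀(f)` would give two distinct rational roots (`exists_two_roots_of_index_four`), both blind,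
contradicting E-an-71 (`not_kummerBlindAtTwo_of_kummerBlindAtTwo_of_ne`).  This is the hypothesis of
`totallyBlindGammaOneTransfer_of_noIndexFour`. [cite: ConradEdixhovenStein2003, §6.1.2 and §6.2] -/
theorem noIndexFour_of_allBlind_of_cusp_rational (hF : optimalGamma1Parametrization_cusp_rational) :
    ∀ (W₁ W₀ : WeierstrassCurve ℚ) [W₁.IsElliptic] [W₁.IsGloballyMinimal] [W₀.IsElliptic]
      [W₀.IsGloballyMinimal] {N : ℕ} [NeZero N] (D₁ : Gamma1ParametrizationData W₁ N)
      (D₀ : ModularParametrizationData W₀ N), IsIsogenous W₁ W₀ → D₁.IsOptimal →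
      (∀ z ∈ D₀.L.lattice, ∃ w ∈ periodLattice D₀.f, z = D₀.c * w) → 2 ^ 2 ∣ N → W₀.a₁ = 0 → W₀.a₃ = 0 →
      AllRationalTwoTorsionBlind W₀ →
      ¬ (∀ z : ℂ, z ∈ periodLatticeGamma1 D₁.f ↔ ∃ w ∈ periodLattice D₀.f, z = 2 * w) := by
  intro W₁ W₀ _ _ _ _ N _ D₁ D₀ hiso h₁ h₀ _h4 ha₁ ha₃ hbl hidx
  have hf : D₁.f = D₀.f := D₁.f_eq_of_isIsogenous D₀ hiso
  obtain ⟨e, e', hne, he, he'⟩ := exists_two_roots_of_index_four hF D₁ D₀ h₁ h₀ hf hidx ha₁ ha₃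
  obtain ⟨A₂, A₄, E, hA₂, hA₄, hE, hb⟩ := hbl e he
  obtain ⟨A₂', A₄', E', hA₂', hA₄', hE', hb'⟩ := hbl e' he'
  have h22 : A₂ = A₂' := by exact_mod_cast hA₂.trans hA₂'.symm
  have h44 : A₄ = A₄' := by exact_mod_cast hA₄.trans hA₄'.symm
  subst h22 h44
  set A₆ : ℤ := -(E ^ 3 + A₂ * E ^ 2 + A₄ * E) with hA₆def
  have heZ : E ^ 3 + A₂ * E ^ 2 + A₄ * E + A₆ = 0 := by rw [hA₆def]; ring
  have hA₆ : (A₆ : ℚ) = W₀.a₆ := by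
    have h := he
    rw [← hE, ← hA₂, ← hA₄] at h
    rw [hA₆def]
    push_cast
    linear_combination -h
  have hEE' : E ≠ E' := by
    rintro rfl
    exact hne (hE.symm.trans hE')
  have he'Z : E' ^ 3 + A₂ * E' ^ 2 + A₄ * E' + A₆ = 0 := by
    have h := he'
    rw [← hE', ← hA₂, ← hA₄, ← hA₆] at h
    exact_mod_cast h
  exact not_kummerBlindAtTwo_of_kummerBlindAtTwo_of_ne W₀ ha₁ ha₃ A₂ A₄ A₆ E E' hA₂ hA₄ hA₆ hEE' heZ he'Z hb hb'

variable {W₁ W₀ : WeierstrassCurve ℚ} [W₁.IsElliptic] [W₁.IsGloballyMinimal] [W₀.IsElliptic]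
  [W₀.IsGloballyMinimal] {N : ℕ} [NeZero N]

/-- **E-an-66 at every level `4 ∣ N`, modulo F★**: for the optimal `X₁(N)`-datum `D₁` and a lattice-optimal `X₀(N)`-datum `D₀`
of a class, `W₀ = [0, a₂, 0, a₄, a₆]` with every rational `2`-torsion point Kummer-blind, `|c₀| = |c₁|`
(`totallyBlindGammaOneTransfer_of_cusp_rational`, unpacked). [cite: ConradEdixhovenStein2003, §6.1.2 and §6.2] -/
theorem natAbs_maninConstant₀_eq_of_allBlind_of_cusp_rational (hF : optimalGamma1Parametrization_cusp_rational)
    (D₁ : Gamma1ParametrizationData W₁ N) (D₀ : ModularParametrizationData W₀ N) (hiso : IsIsogenous W₁ W₀)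
    (h₁ : D₁.IsOptimal) (h₀ : ∀ z ∈ D₀.L.lattice, ∃ w ∈ periodLattice D₀.f, z = D₀.c * w) (h4 : 2 ^ 2 ∣ N)
    (ha₁ : W₀.a₁ = 0) (ha₃ : W₀.a₃ = 0) (hblind : AllRationalTwoTorsionBlind W₀) :
    D₀.maninConstant.natAbs = D₁.maninConstant.natAbs :=
  totallyBlindGammaOneTransfer_of_cusp_rational hF W₁ W₀ D₁ D₀ hiso h₁ h₀ h4 ha₁ ha₃ hblind

/-- **On a totally blind optimal curve at `4 ∣ N`: `2 ∤ c₀ ⟺ 2 ∤ c₁`** (F★-conditional) — Manin's conjecture at `2` for `D₀` IS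
Stevens' parity for the `X₁(N)`-optimal datum `D₁` of the class. [cite: ConradEdixhovenStein2003, §6.1.2 and §6.2] -/
theorem not_two_dvd_maninConstant₀_iff_of_allBlind_of_cusp_rational (hF : optimalGamma1Parametrization_cusp_rational)
    (D₁ : Gamma1ParametrizationData W₁ N) (D₀ : ModularParametrizationData W₀ N) (hiso : IsIsogenous W₁ W₀)
    (h₁ : D₁.IsOptimal) (h₀ : ∀ z ∈ D₀.L.lattice, ∃ w ∈ periodLattice D₀.f, z = D₀.c * w) (h4 : 2 ^ 2 ∣ N)
    (ha₁ : W₀.a₁ = 0) (ha₃ : W₀.a₃ = 0) (hblind : AllRationalTwoTorsionBlind W₀) :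
    ¬ (2 : ℤ) ∣ D₀.maninConstant ↔ ¬ (2 : ℤ) ∣ D₁.maninConstant := by
  have heq := natAbs_maninConstant₀_eq_of_allBlind_of_cusp_rational hF D₁ D₀ hiso h₁ h₀ h4 ha₁ ha₃ hblind
  rw [← Int.natAbs_dvd_natAbs, ← Int.natAbs_dvd_natAbs (b := D₁.maninConstant), heq]

/-- Divisor form: on a totally blind optimal curve at `4 ∣ N`, `ℓ ∣ c₀ ⟺ ℓ ∣ c₁` for every integer `ℓ` (F★-conditional).
[cite: ConradEdixhovenStein2003, §6.1.2 and §6.2] -/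
theorem dvd_maninConstant₀_iff_of_allBlind_of_cusp_rational (hF : optimalGamma1Parametrization_cusp_rational)
    (D₁ : Gamma1ParametrizationData W₁ N) (D₀ : ModularParametrizationData W₀ N) (hiso : IsIsogenous W₁ W₀)
    (h₁ : D₁.IsOptimal) (h₀ : ∀ z ∈ D₀.L.lattice, ∃ w ∈ periodLattice D₀.f, z = D₀.c * w) (h4 : 2 ^ 2 ∣ N)
    (ha₁ : W₀.a₁ = 0) (ha₃ : W₀.a₃ = 0) (hblind : AllRationalTwoTorsionBlind W₀) (ℓ : ℤ) :
    ℓ ∣ D₀.maninConstant ↔ ℓ ∣ D₁.maninConstant := by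
  have heq := natAbs_maninConstant₀_eq_of_allBlind_of_cusp_rational hF D₁ D₀ hiso h₁ h₀ h4 ha₁ ha₃ hblind
  rw [← Int.natAbs_dvd_natAbs, ← Int.natAbs_dvd_natAbs (b := D₁.maninConstant), heq]

omit [W₀.IsElliptic] in
/-- **C2 on EVERY totally blind lattice-optimal curve at `4 ∣ N` ⟸ F★ ∧ (existence of Stevens' datum) ∧ (Stevens' parity there).**
With F★, the printed F-need `exists_optimal_gamma1ParametrizationData` (Conrad–Edixhoven–Stein §6.1) and `2 ∤ c₁` for the
`X₁(N)`-optimal data of the classes of totally blind `X₀(N)`-optimal curves at the level (`hS`, inline; CES Conj. 6.1.7 predicts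
`c₁ = 1`), every such curve has odd Manin constant — the blind residual of C2 (tame AND wild) is Stevens' parity.
[cite: ConradEdixhovenStein2003, §6.1.2 and §6.2] [cite: ConradEdixhovenStein2003, §6.1 Conj. 6.1.7 (shape)] -/
theorem not_two_dvd_maninConstant_of_allBlind_of_cusp_rational [W₀.IsElliptic]
    (hex : exists_optimal_gamma1ParametrizationData) (hF : optimalGamma1Parametrization_cusp_rational)
    (hS : ∀ (W₁ W₀ : WeierstrassCurve ℚ) [W₁.IsElliptic] [W₁.IsGloballyMinimal] [W₀.IsElliptic]
      [W₀.IsGloballyMinimal] (D₁ : Gamma1ParametrizationData W₁ N) (D₀ : ModularParametrizationData W₀ N),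
      IsIsogenous W₁ W₀ → D₁.IsOptimal → (∀ z ∈ D₀.L.lattice, ∃ w ∈ periodLattice D₀.f, z = D₀.c * w) →
      W₀.a₁ = 0 → W₀.a₃ = 0 → AllRationalTwoTorsionBlind W₀ → ¬ (2 : ℤ) ∣ D₁.maninConstant)
    (D₀ : ModularParametrizationData W₀ N) (h₀ : ∀ z ∈ D₀.L.lattice, ∃ w ∈ periodLattice D₀.f, z = D₀.c * w)
    (h4 : 2 ^ 2 ∣ N) (ha₁ : W₀.a₁ = 0) (ha₃ : W₀.a₃ = 0) (hblind : AllRationalTwoTorsionBlind W₀) :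
    ¬ (2 : ℤ) ∣ D₀.maninConstant := by
  obtain ⟨W₁, i₁, i₂, D₁, hiso, h₁⟩ := hex W₀ D₀ h₀
  exact (not_two_dvd_maninConstant₀_iff_of_allBlind_of_cusp_rational hF D₁ D₀ hiso h₁ h₀ h4 ha₁ ha₃ hblind).mpr
    (hS W₁ W₀ D₁ D₀ hiso h₁ h₀ ha₁ ha₃ hblind)

end Summit.BirchSwinnertonDyer.BirchSwinnertonDyer.Theorems.ManinLocalTwoThree

end
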